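import Summits.CriticalPhenomena.PercolationContinuityZ3.Theorems.PercNearOneGluingNoHeavyPcintChordMemSound
import Summits.CriticalPhenomena.PercolationContinuityZ3.Theorems.PercNearOneGluingNoHeavyPcintChainBondReduction
import Summits.CriticalPhenomena.PercolationContinuityZ3.Theorems.PercNearOneGluingNoHeavyPcintNawChainMemAlong
import HarnessLib

/-!
# PCINT lane, reduction B3c (`chordchain_cw`) on the memory-`τ` DANGEROUS-SET automaton — the automaton and the unit comparison

Cell `prim-pcint` (PAPER-2 track (iii): certified intervals for `p_c(ℤ^d)`), seat `prim-pcint-2` (gen 4); support file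
(`--supports stmt-CriticalPhenomena-4575`).  Does NOT build on p205010.  Memo: `run/shared/lean/prim/pcint/REDUCTIONS.md` §B3c,
§B2c.7 (visibility = remembered set).

The B3c automaton `bchainMemAut τ kc` on the dangerous-set states of `…PcintMemAutomaton` (step `mstep τ`) refines the B3r automaton
`chordMemAut` of `…PcintChordMem`: for every lattice neighbour `w` of the new vertex (other than the endpoint and the remembered
sites) with remembered incidences `bcinc S w`, it pays
* nothing unless the most recent remembered incidence is LINKED (age `+ 1 ≤ kc`, `clinked`);
* if some remembered incidence has age `≥ 2` (`cdetSite`): `1 + [bcbonus]` units `s̄`, where the BONUS is granted iff the most recent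
  incidence `q₁` has `age(q₁) + kc + 3 ≤ τ` and no other remembered incidence has age `≤ age(q₁) + kc` (`bcbonus`; then every
  incidence in that range WOULD be remembered, so there is none: REDUCTIONS §B2c.7 (V2));
* otherwise (the corner site, claimed by `bcorner`): the coin `κ̄ ≥ (1 + s̄²)/2` (two units: the corner pair and its chain-start
  bonus, which is decidable as soon as `kc + 4 ≤ τ`);
and `((1-p)·r²)^{bchord}` per detected chord (refund `r ≥ 1/s` for up to two on-path units per chord).
PROVED here: the per-time decomposition of the full-information units `detTotal = Σ_T dunitsAt T` (`…ChainBondUnits`) and the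
UNIT COMPARISON `one_add_bcbonus_le_uF`: along a self-avoiding word, at a detected off-path site the automaton pays at most the
full-information units of that incidence (`kc + 4 ≤ τ`).  The per-step domination and the glue are in `…PcintChainMemStep/Sound`.
-/

noncomputable section

namespace Summit.CriticalPhenomena.PercolationContinuityZ3.Theorems.Pcint

open Finset Literature.Probability.Percolation Literature.Probability.LatticeModels ChainBond

variable {d : ℕ}

/-! ### The B3c automaton on dangerous-set states -/

/-- The remembered incidences of the (relative) site `w`. [folklore] -/
def bcinc (S : MState d) (w : Site d) : Finset (Site d × ℕ) := S.filter fun q => (zdGraph d).Adj q.1 w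

/-- Membership in `bcinc`. [folklore] -/
theorem mem_bcinc {S : MState d} {w : Site d} {q : Site d × ℕ} : q ∈ bcinc S w ↔ q ∈ S ∧ (zdGraph d).Adj q.1 w := by
  rw [bcinc, mem_filter]

/-- LINKED: some remembered incidence has age `+ 1 ≤ kc` (i.e. gap `≤ kc` to the new vertex). [folklore] -/
def clinked (kc : ℕ) (S : MState d) (w : Site d) : Prop := ∃ q ∈ bcinc S w, q.2 + 1 ≤ kc

/-- DETERMINISTIC evidence: some remembered incidence has age `≥ 2` (gap `≥ 3`, a shortcut pair for every order). [folklore] -/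
def cdetSite (S : MState d) (w : Site d) : Prop := ∃ q ∈ bcinc S w, 2 ≤ q.2

/-- BONUS (REDUCTIONS §B2c.7 (V2)): the most recent remembered incidence `q₁` is linked, `age(q₁) + kc + 3 ≤ τ`, and every other
remembered incidence is older than `age(q₁) + kc`. [folklore] -/
def bcbonus (τ kc : ℕ) (S : MState d) (w : Site d) : Prop :=
  ∃ q₁ ∈ bcinc S w, q₁.2 + 1 ≤ kc ∧ q₁.2 + kc + 3 ≤ τ ∧ ∀ q ∈ bcinc S w, q ≠ q₁ → q₁.2 + kc < q.2

open Classical in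
/-- The DET-PAYING neighbour sites of the step: neighbours of the new vertex other than the endpoint and the remembered sites,
with deterministic evidence and a linked incidence. [folklore] -/
def cdetSet (kc : ℕ) (S : MState d) (a : Fin d × Bool) : Finset (Site d) :=
  (nbrSites (stepVec a)).filter fun w => w ≠ 0 ∧ (∀ q ∈ S, q.1 ≠ w) ∧ cdetSite S w ∧ clinked kc S w

open Classical in
/-- The number of deterministic units of the step: one per det-paying site plus one per granted bonus. [folklore] -/
def cdet (τ kc : ℕ) (S : MState d) (a : Fin d × Bool) : ℕ :=
  (cdetSet kc S a).card + ((cdetSet kc S a).filter fun w => bcbonus τ kc S w).card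

/-- The number of deterministic units is at most `4d`. [folklore] -/
theorem cdet_le (τ kc : ℕ) (S : MState d) (a : Fin d × Bool) : cdet τ kc S a ≤ 4 * d := by
  classical
  unfold cdet
  have h1 : (cdetSet kc S a).card ≤ 2 * d := (card_filter_le _ _).trans (card_nbrSites_le _)
  have h2 : ((cdetSet kc S a).filter fun w => bcbonus τ kc S w).card ≤ 2 * d := (card_filter_le _ _).trans h1
  omega

/-- Det-paying sites are detected gap sites of the B3r automaton. [folklore] -/
theorem cdetSet_subset_bgapSet (kc : ℕ) (S : MState d) (a : Fin d × Bool) : cdetSet kc S a ⊆ bgapSet S a := by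
  classical
  intro w hw
  rw [cdetSet, mem_filter] at hw
  obtain ⟨hn, h0, hnot, ⟨q, hq, hq2⟩, -⟩ := hw
  exact mem_filter.2 ⟨hn, h0, hnot, q, (mem_bcinc.1 hq).1, hq2, (mem_bcinc.1 hq).2⟩

/-- The B3c step factor `cr^{bchord} · s̄^{cdet} · κ̄^{[bcorner]}` (`cr = (1-p) r²`). [folklore] -/
def bcwt (cr sb κb : ℝ) (τ kc : ℕ) (S : MState d) (a : Fin d × Bool) : ℝ :=
  cr ^ bchord S a * (sb ^ cdet τ kc S a * (if bcorner S a then κb else 1))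

/-- The step factor is nonnegative. [folklore] -/
theorem bcwt_nonneg {cr sb κb : ℝ} (hcr : 0 ≤ cr) (hsb : 0 ≤ sb) (hκb : 0 ≤ κb) (τ kc : ℕ) (S : MState d) (a : Fin d × Bool) :
    0 ≤ bcwt cr sb κb τ kc S a := by
  unfold bcwt; split_ifs <;> positivity

/-- **The B3c automaton on dangerous-set states** (memory `τ`, chain parameter `kc`): step `mstep τ`, weight
`p · cr^{bchord} · s̄^{cdet} · κ̄^{[bcorner]}`. [folklore] -/
def bchainMemAut (τ kc : ℕ) (p cr sb κb : ℝ) (hp : 0 ≤ p) (hcr : 0 ≤ cr) (hsb : 0 ≤ sb) (hκb : 0 ≤ κb) :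
    WAut (MState d) (Fin d × Bool) where
  step := mstep τ
  wt S a := p * bcwt cr sb κb τ kc S a
  wt_nonneg S a := mul_nonneg hp (bcwt_nonneg hcr hsb hκb τ kc S a)

/-! ### The full-information units, time by time -/

namespace ChainBond

variable {n : ℕ}

/-- The full-information units of the incidence of `w` at time `T` (base unit and bonus unit of the incidence index `k`
with `t_k = T`). [folklore] -/
def uF (kc : ℕ) (γ : Fin n → Fin d × Bool) (w : Site d) (T : ℕ) : ℕ :=
  ((paySet kc γ w).filter fun k => incAt γ w k = T).card + ((bonusSet kc γ w).filter fun k => incAt γ w k = T).card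

/-- The full-information units paid at time `T`, over all off-path sites. [folklore] -/
def dunitsAt (kc : ℕ) (γ : Fin n → Fin d × Bool) (T : ℕ) : ℕ := ∑ w ∈ offSites γ, uF kc γ w T

/-- **`detTotal = Σ_T dunitsAt T`.** [folklore] -/
theorem detTotal_eq_sum (kc : ℕ) (γ : Fin n → Fin d × Bool) : detTotal kc γ = ∑ T ∈ range (n + 1), dunitsAt kc γ T := by
  classical
  unfold detTotal dunitsAt
  rw [sum_comm]
  refine sum_congr rfl fun w _ => ?_
  have hmaps : ∀ k, k < (incTimes γ w).card → incAt γ w k ∈ range (n + 1) := fun k hk =>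
    mem_range.2 (Nat.lt_succ_of_le (mem_incTimes.1 (incAt_mem hk)).1)
  unfold detUnits uF
  rw [sum_add_distrib, card_eq_sum_card_fiberwise (f := incAt γ w) (t := range (n + 1))
      (fun k hk => hmaps k (mem_paySet.1 (mem_coe.1 hk)).2.1),
    card_eq_sum_card_fiberwise (f := incAt γ w) (t := range (n + 1))
      (fun k hk => hmaps k (mem_bonusSet.1 (mem_coe.1 hk)).1.2.1)]

/-- A paid incidence index contributes its units to its time. [folklore] -/
theorem le_uF {kc : ℕ} {γ : Fin n → Fin d × Bool} {w : Site d} {k T : ℕ} (hk : incAt γ w k = T) (hp : paysAt kc γ w k) :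
    1 + (if bonusAt kc γ w k then 1 else 0) ≤ uF kc γ w T := by
  classical
  unfold uF
  have h1 : 1 ≤ ((paySet kc γ w).filter fun k => incAt γ w k = T).card :=
    card_pos.2 ⟨k, mem_filter.2 ⟨mem_paySet.2 hp, hk⟩⟩
  split_ifs with hb
  · have h2 : 1 ≤ ((bonusSet kc γ w).filter fun k => incAt γ w k = T).card :=
      card_pos.2 ⟨k, mem_filter.2 ⟨mem_bonusSet.2 hb, hk⟩⟩
    omega
  · omega

end ChainBond

/-! ### The unit comparison along a self-avoiding word -/

section Along

variable (a₀ : Fin d × Bool) {τ kc n : ℕ} {γ : Fin n → Fin d × Bool}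

/-- **Retention**: an incidence `v_i ~ w` of a neighbour `w` of the new vertex `v_{t+1}`, of age `t - i ≤ τ - 3` (`i < t`), is
remembered at time `t` (it is within `ℓ¹`-distance `3` of `v_t`). [folklore] -/
theorem isRem_of_adj {t i : ℕ} (ht : t < n) (hit : i < t) (hage : t ≤ i + (τ - 3)) (hτ : 3 ≤ τ) {w : Site d}
    (hw : (zdGraph d).Adj (wordPos γ (t + 1)) w) (hi : (zdGraph d).Adj (wordPos γ i) w) : IsRem τ γ i t := by
  refine ⟨by omega, by omega, ?_⟩
  have h1 := l1_sub_of_adj hi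
  have h2 := l1_sub_of_adj hw
  have h3 := l1_sub_of_adj (zdGraph_adj_wordPos_succ γ ht)
  have : l1 (wordPos γ i - wordPos γ t) ≤ 3 := by
    have e : wordPos γ i - wordPos γ t = (wordPos γ i - w) + (-(wordPos γ (t + 1) - w)) + (-(wordPos γ t - wordPos γ (t + 1))) := by
      abel
    rw [e]
    refine (l1_add_le _ _).trans ?_
    rw [l1_neg, h3]
    refine Nat.add_le_add_right ((l1_add_le _ _).trans ?_) 1
    rw [l1_neg, h1, h2]
  omega

/-- A remembered incidence (relative) of the translated site is an incidence time of the absolute site, earlier than `t`,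
of the recorded age. [folklore] -/
theorem inc_of_mem_bcinc {t : ℕ} (ht : t < n) {w' : Site d} {q : Site d × ℕ} (hq : q ∈ bcinc (danger τ (pre a₀ γ t)) w') :
    t - q.2 ∈ incTimes γ (w' + wordPos γ t) ∧ 1 ≤ q.2 ∧ q.2 ≤ t ∧ IsRem τ γ (t - q.2) t := by
  obtain ⟨hqS, hadj⟩ := mem_bcinc.1 hq
  obtain ⟨hle, hrem, hq1⟩ := isRem_of_mem_danger_pre a₀ ht.le hqS
  refine ⟨mem_incTimes.2 ⟨by omega, ?_⟩, hrem.1 |> fun h => by omega, hle, hrem⟩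
  rw [← adj_sub_wordPos_iff γ t, ← hq1, add_sub_cancel_right]; exact hadj

/-- Conversely a remembered incidence of the absolute site is in `bcinc`. [folklore] -/
theorem mem_bcinc_of_isRem {t i : ℕ} (ht : t < n) {w' : Site d} (hrem : IsRem τ γ i t)
    (hadj : (zdGraph d).Adj (wordPos γ i) (w' + wordPos γ t)) :
    (wordPos γ i - wordPos γ t, t - i) ∈ bcinc (danger τ (pre a₀ γ t)) w' := by
  refine mem_bcinc.2 ⟨mem_danger_pre_of_isRem a₀ ht.le hrem, ?_⟩
  have := (adj_sub_wordPos_iff γ t (wordPos γ i) (w' + wordPos γ t)).2 hadj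
  rwa [add_sub_cancel_right] at this

open Classical in
/-- **Unit comparison** (REDUCTIONS §B3c with remembered visibility): at a det-paying site off the path, the automaton's units
`1 + [bcbonus]` are at most the full-information units `uF` of that incidence (`kc + 4 ≤ τ`). [folklore] -/
theorem one_add_bcbonus_le_uF (hτ : kc + 4 ≤ τ) {t : ℕ} (ht : t < n) {w' : Site d}
    (hw' : w' ∈ cdetSet kc (danger τ (pre a₀ γ t)) (γ ⟨t, ht⟩)) :
    1 + (if bcbonus τ kc (danger τ (pre a₀ γ t)) w' then 1 else 0) ≤ uF kc γ (w' + wordPos γ t) (t + 1) := by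
  classical
  set S := danger τ (pre a₀ γ t) with hS
  set w := w' + wordPos γ t with hw
  rw [cdetSet, mem_filter, mem_nbrSites] at hw'
  obtain ⟨hadj', -, -, ⟨qd, hqd, hqd2⟩, ⟨ql, hql, hqlk⟩⟩ := hw'
  -- absolute adjacency of `w` to the new vertex
  have hadj : (zdGraph d).Adj (wordPos γ (t + 1)) w := by
    rw [hw, ← adj_sub_wordPos_iff γ t, ← stepVec_eq_sub ht, add_sub_cancel_right]; exact hadj'
  have hT : t + 1 ∈ incTimes γ w := mem_incTimes.2 ⟨by omega, hadj⟩
  -- `t` itself is not an incidence (no triangles)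
  have ht_not : t ∉ incTimes γ w := fun h =>
    zdGraph_no_triangle (zdGraph_adj_wordPos_succ γ ht) hadj (mem_incTimes.1 h).2
  obtain ⟨k, hk, hkT⟩ := exists_incAt_eq hT
  -- every incidence `< t + 1` has index `< k`, and `incAt (k-1)` is the largest of them
  have hidx : ∀ {i}, i ∈ incTimes γ w → i < t + 1 → ∃ j, j < k ∧ incAt γ w j = i := by
    intro i hi hit
    obtain ⟨j, hj, hji⟩ := exists_incAt_eq hi
    refine ⟨j, ?_, hji⟩
    by_contra hjk
    rcases Nat.lt_or_ge k j with h | h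
    · have := incAt_strictMono h hj; omega
    · have : j = k := by omega
      subst this; omega
  have hprev_ge : ∀ {i}, i ∈ incTimes γ w → i < t + 1 → i ≤ incAt γ w (k - 1) := by
    intro i hi hit
    obtain ⟨j, hj, hji⟩ := hidx hi hit
    rw [← hji]
    rcases Nat.lt_or_ge j (k - 1) with h | h
    · exact (incAt_strictMono h (by omega)).le
    · have : j = k - 1 := by omega
      rw [this]
  -- the remembered incidences as absolute incidence times
  obtain ⟨hqd_inc, hqd1, hqd_le, -⟩ := inc_of_mem_bcinc a₀ ht hqd
  obtain ⟨hql_inc, hql1, hql_le, -⟩ := inc_of_mem_bcinc a₀ ht hql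
  have hk1 : 1 ≤ k := by
    obtain ⟨j, hj, -⟩ := hidx hqd_inc (by omega)
    omega
  have hprev_lt : incAt γ w (k - 1) < t + 1 := by rw [← hkT]; exact incAt_strictMono (by omega) hk
  have hprev_mem : incAt γ w (k - 1) ∈ incTimes γ w := incAt_mem (by omega)
  have hprev_le_t1 : incAt γ w (k - 1) ≤ t - 1 := by
    have h1 : incAt γ w (k - 1) ≠ t := fun h => ht_not (h ▸ hprev_mem)
    omega
  -- linked
  have hlinked : linkedAt kc γ w k := by
    refine ⟨hk1, ?_⟩
    have := hprev_ge hql_inc (by omega)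
    omega
  -- not the corner first pair (there is an incidence of age ≥ 2, i.e. older than `t - 1`)
  have hnotfirst : ¬ (k = 1 ∧ firstCorner γ w) := by
    rintro ⟨rfl, -, h01⟩
    obtain ⟨j, hj, hji⟩ := hidx hqd_inc (by omega)
    have hj0 : j = 0 := by omega
    subst hj0
    omega
  have hpays : paysAt kc γ w k := ⟨hk1, hk, hlinked, hnotfirst⟩
  refine le_trans ?_ (le_uF hkT hpays)
  by_cases hb : bcbonus τ kc S w'
  · -- the bonus is genuine
    rw [if_pos hb]
    suffices hbon : bonusAt kc γ w k by rw [if_pos hbon]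
    obtain ⟨q₁, hq₁, hq₁k, hq₁τ, hothers⟩ := hb
    obtain ⟨hq₁_inc, hq₁1, hq₁_le, -⟩ := inc_of_mem_bcinc a₀ ht hq₁
    -- `q₁` is the incidence `incAt (k-1)`
    have hq₁prev : t - q₁.2 = incAt γ w (k - 1) := by
      have hle := hprev_ge hq₁_inc (by omega)
      by_contra hne
      have hlt : t - q₁.2 < incAt γ w (k - 1) := lt_of_le_of_ne hle hne
      -- then `incAt (k-1)` is a younger incidence, remembered, contradicting `hothers`
      have hage : t ≤ incAt γ w (k - 1) + (τ - 3) := by omega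
      have hremp : IsRem τ γ (incAt γ w (k - 1)) t :=
        isRem_of_adj (by exact ht) (by omega) hage (by omega) hadj (mem_incTimes.1 hprev_mem).2
      have hmem := mem_bcinc_of_isRem a₀ ht (w' := w') hremp (by rw [← hw]; exact (mem_incTimes.1 hprev_mem).2)
      have hne' : (wordPos γ (incAt γ w (k - 1)) - wordPos γ t, t - incAt γ w (k - 1)) ≠ q₁ := by
        intro h; have := congrArg Prod.snd h; simp only at this; omega
      have := hothers _ hmem hne'
      simp only at this
      omega
    refine ⟨hpays, ?_⟩
    by_cases hk2 : k = 1
    · exact Or.inl hk2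
    · right
      rintro ⟨-, hlk⟩
      -- `incAt (k-2)` would be an incidence of age in `(age q₁, age q₁ + kc]`, remembered, contradicting `hothers`
      have hk2' : 2 ≤ k := by omega
      have hm2 : incAt γ w (k - 1 - 1) ∈ incTimes γ w := incAt_mem (by omega)
      have hlt2 : incAt γ w (k - 1 - 1) < incAt γ w (k - 1) := incAt_strictMono (by omega) (by omega)
      have hage2 : t ≤ incAt γ w (k - 1 - 1) + (τ - 3) := by omega
      have hrem2 : IsRem τ γ (incAt γ w (k - 1 - 1)) t :=
        isRem_of_adj (by exact ht) (by omega) hage2 (by omega) hadj (mem_incTimes.1 hm2).2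
      have hmem2 := mem_bcinc_of_isRem a₀ ht (w' := w') hrem2 (by rw [← hw]; exact (mem_incTimes.1 hm2).2)
      have hne2 : (wordPos γ (incAt γ w (k - 1 - 1)) - wordPos γ t, t - incAt γ w (k - 1 - 1)) ≠ q₁ := by
        intro h; have := congrArg Prod.snd h; simp only at this; omega
      have := hothers _ hmem2 hne2
      simp only at this
      omega
  · rw [if_neg hb]
    split_ifs <;> omega

/-- **A claimed corner that is not genuine is a paid incidence**: if the corner site `C` is off the path but the corner is not
genuine (an older incidence of `C` exists), then `C` is not det-paying (no remembered incidence of age `≥ 2`) and its incidence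
`t + 1` carries at least one full-information unit. [folklore] -/
theorem one_le_uF_cornerSite (hkc : 2 ≤ kc) {t : ℕ} (ht : t < n)
    (hc : bcorner (danger τ (pre a₀ γ t)) (γ ⟨t, ht⟩) = true) (hcoff : cornerSite γ (t - 1) ∉ pathSites γ)
    (hnc : ¬ IsCorner γ (t - 1)) :
    1 ≤ uF kc γ (cornerSite γ (t - 1)) (t + 1) ∧ cornerSite γ (t - 1) - wordPos γ t ∉ cdetSet kc (danger τ (pre a₀ γ t)) (γ ⟨t, ht⟩) := by
  classical
  obtain ⟨ht1, haxes, hCdef, hC1, hC2, hCne, hnot, hfree⟩ := bcorner_spec a₀ ht hc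
  set C := cornerSite γ (t - 1) with hC
  constructor
  · -- an older incidence exists
    have hold : ∃ i, i < t - 1 ∧ (zdGraph d).Adj (wordPos γ i) C := by
      by_contra hno
      push Not at hno
      apply hnc
      refine ⟨by omega, ?_, hcoff, fun i hi => hno i (mem_range.1 hi)⟩
      have e1 : (⟨t - 1 + 1, by omega⟩ : Fin n) = ⟨t, ht⟩ := Fin.ext (by simp only; omega)
      rw [e1]; exact haxes
    obtain ⟨i, hi, hiC⟩ := hold
    have hT : t + 1 ∈ incTimes γ C := mem_incTimes.2 ⟨by omega, hC1⟩
    have hTm1 : t - 1 ∈ incTimes γ C := mem_incTimes.2 ⟨by omega, hC2⟩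
    have hI : i ∈ incTimes γ C := mem_incTimes.2 ⟨by omega, hiC⟩
    have ht_not : t ∉ incTimes γ C := fun h =>
      zdGraph_no_triangle (zdGraph_adj_wordPos_succ γ ht) hC1 (mem_incTimes.1 h).2
    obtain ⟨k, hk, hkT⟩ := exists_incAt_eq hT
    -- indices below `k`
    have hidx : ∀ {j'}, j' ∈ incTimes γ C → j' < t + 1 → ∃ j, j < k ∧ incAt γ C j = j' := by
      intro i' hi' hit
      obtain ⟨j, hj, hji⟩ := exists_incAt_eq hi'
      refine ⟨j, ?_, hji⟩
      by_contra hjk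
      rcases Nat.lt_or_ge k j with h | h
      · have := incAt_strictMono h hj; omega
      · have : j = k := by omega
        subst this; omega
    obtain ⟨j1, hj1, hj1e⟩ := hidx hTm1 (by omega)
    obtain ⟨j0, hj0, hj0e⟩ := hidx hI (by omega)
    have hj01 : j0 < j1 := by
      by_contra h
      rcases Nat.lt_or_ge j1 j0 with h' | h'
      · have := incAt_strictMono h' (by omega : j0 < (incTimes γ C).card); omega
      · have : j0 = j1 := by omega
        subst this; omega
    have hk2 : 2 ≤ k := by omega
    -- `incAt (k-1) = t - 1`
    have hprev : incAt γ C (k - 1) = t - 1 := by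
      have h1 : incAt γ C j1 ≤ incAt γ C (k - 1) := by
        rcases Nat.lt_or_ge j1 (k - 1) with h | h
        · exact (incAt_strictMono h (by omega)).le
        · have : j1 = k - 1 := by omega
          rw [this]
      have h2 : incAt γ C (k - 1) < t + 1 := by rw [← hkT]; exact incAt_strictMono (by omega) hk
      have h3 : incAt γ C (k - 1) ≠ t := fun h => ht_not (h ▸ incAt_mem (by omega))
      omega
    have hpays : paysAt kc γ C k :=
      ⟨by omega, hk, ⟨by omega, by rw [hkT, hprev]; omega⟩, fun h => by omega⟩
    exact le_trans (by omega) (le_uF hkT hpays)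
  · intro hmem
    rw [cdetSet, mem_filter] at hmem
    obtain ⟨-, -, -, ⟨q, hq, hq2⟩, -⟩ := hmem
    exact hfree q (mem_bcinc.1 hq).1 hq2 (mem_bcinc.1 hq).2

end Along

end Summit.CriticalPhenomena.PercolationContinuityZ3.Theorems.Pcint
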